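/-
Copyright (c) 2026 the pub-hodgecm-mathlib formalisation cell (harness21).  Prover seat hodgecm-mathlib-F0P2-p11 (g3): Track B «K2-LIT»,
hLiu418 = stmt-HodgeConjecture-24832; LEAD F0P6-plan (g14) BATCH #155 (1) «(K1a-3) ∕ D-2», line lead K2E5-p16 (g8); census (β) 2026-09-05T00:10Z (1):
the VALUE EDITION of ★ `K2LiuA7NormalisedRegularityAllS0.exists_normalised_family_allS0` (K2Liu-p27 (g0)).
-/
import Summits.HodgeConjecture.HodgeConjecture.Theorems.K2LiuA7NormalisedRegularityAllS0   -- ★ AllS0 file 1: `isQRationalRegularAt_normalised_base_at` (+ ★ B7-S, ★ B3)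
import Summits.HodgeConjecture.HodgeConjecture.Theorems.K2LiuRankOneStageTwistedBall          -- ★ p863296 (this seat): `isQRationalRegularAt_normAbs_cpow_neg_affine`
import HarnessLib

/-!
# Crux `HLiu418`, road `K2_Liu`, KIND 1 a♮, file (K1a-3)-VALUE: ONE RANK-ONE STAGE OF THE COCYCLE — THE NORMALISED FAMILY IS `L(e(s)−1,ν)⁻¹ · ∫ Φ_s(w₀ u(x) g) dμ`
# AT EVERY `s` WHERE THE STAGE CONVERGES (`1 < re e(s)`), not only on `1 < re s`

Cell `hodgecm-mathlib`, crux item hLiu418 = `stmt-HodgeConjecture-24832`; squad K2 ∕ K2Liu; prover F0P2-p11 (g3) (K1 desk lineage); line lead K2E5-p16 (g8).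
THEOREMS ONLY (no `def`, no instance, no notation, no named-fact hypothesis, no `sorry`); lane `--supports stmt-HodgeConjecture-24832 --as helper` (count-neutral).
Currency = ★ `exists_normalised_family_allS0` VERBATIM (a group `G`, the completion `K_w`, an additive Haar measure `μ`, the rank-one letters `u ū w₀ ν a c C₀ hrel`
of ★ B3, a right level `K′`, a base `q₀` with `q_w = q₀^d`).

THE POINT (census (β) (1), K2 bus 2026-09-05T00:10Z).  In the three-stage chain for the rank-one (corner-twisted) coefficient of the Siegel big cell (★ p29
`K2LiuRankOneSingularLocalRegularity`, ★ p863369 ∕ p863413 this seat) the `SL₂` exponents are `e_A(s) = 2s+2`, `e_B(s) = 2s+1`, `e_C(s) = 2s`; one stage converges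
absolutely as soon as `1 < re e(s)` (★ B3 `integrable_and_integral_eq`), i.e. stage A on `re s > −½`, stage B on `re s > 0` — both AT `s = ½` — while only the twisted
stage C is borderline there (hence the ball form ★ p863296).  But ★ `exists_normalised_family_allS0` exports the value identity `∫ Φ_s(w₀ u(x) g) dμ = L(e(s)−1,ν)·N s g`
on `1 < re s` ONLY (its letters `hΦK`, `hrel` are asked there), with `N` ∃-opaque; so the stage families `N₁(½)`, `N₂(½)` of ★ p863369 cannot be read as the literal
convergent integrals they are.  THIS FILE re-exports the family with the value clause at every convergent point:
* §1 **`exists_normalised_family_value`** — ★ `exists_normalised_family_allS0`'s binders and clauses (i)(ii) VERBATIM for the SAME explicit `N` (★ B3's normalised value at the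
  per-point data), PLUS (iii): at every `s` with `1 < re (a s + c)` at which `Φ_s` is right-`K′`-invariant and satisfies the `SL₂` relation (the two letters (ii) assumes on
  the half-plane, asked at the point), `x ↦ Φ_s(w₀ u(x) g)` is integrable and `∫ Φ_s(w₀ u(x) g) dμ(x) = L(a s + c − 1, ν) · N s g` (★ B3 at the point).
* §2 **`exists_normalised_family_value_regular`** (`q₀ ≥ 2`) — (iii′): the same at every `s₀` with `1 < re (a s₀ + c)` where `C₀` and all point values are `q₀^{-s}`-rational
  and regular, the two letters being TRANSFERRED from the half-plane by the identity principle ★ `IsQRationalRegularAt.eq_of_eqOn_halfPlane` (the `SL₂` relation is an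
  identity of `q₀^{-s}`-rational functions: point values, `C₀`, and the Laurent monomial `‖x‖^{−(as+c)}` ★ p863296 `isQRationalRegularAt_normAbs_cpow_neg_affine`) — the
  form the frame chain consumes for its CONTINUED stage-B input `N₁`.
CONSUMER: the frame-level siblings (this seat, next) upgrade ★ p863369 ∕ p863413's provenance clauses (d)(e) from `1 < re s` to `re s > −½` ∕ `re s > 0`, so the D-2
seam value `N₂(½)(φ(w₂)φ(u_{2e₂}(ι x δ)) h_v)` (K2Liu-p12 (g5)'s `N₂val`) is an honest convergent double integral of the generator `f_{½}` itself.
HONEST LABEL.  `HC_CM` is proved only modulo the 7 printed citations (2 remaining named inputs: hLiu418 = `stmt-HodgeConjecture-24832`,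
h413 = `stmt-HodgeConjecture-24833`) until rung 0 closes; this file is a count-neutral helper and closes no socket.

## References
* [Casselman1980] W. Casselman, *The unramified principal series of p-adic groups I*, Compositio Math. 40 (1980), §3 Thm. 3.1 (rank-one operators).
* [KudlaSweet1997] S. Kudla, W. J. Sweet, Israel J. Math. 98 (1997), §1 (rationality in `q^{-s}`; the identity principle for local factors).
* [Tate1950] J. Tate, *Fourier analysis in number fields and Hecke's zeta-functions* (1950), §2.5 (local factors `L(e−1, ν)`).
-/

set_option autoImplicit false
set_option linter.dupNamespace false -- the mandated namespace repeats `HodgeConjecture.HodgeConjecture`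

noncomputable section

open MeasureTheory
open scoped NNReal ENNReal
open NumberField IsDedekindDomain
open Literature.NumberTheory.GaloisRepresentations.IsNonarchimedeanLocalField
open Literature.NumberTheory.Automorphic Literature.NumberTheory.Automorphic.UnitaryGroup Literature.NumberTheory.Automorphic.LocalFieldHaar
open Summit.HodgeConjecture.HodgeConjecture.Cruxes.HLiu418.K2LiuQRationalDefs
open Summit.HodgeConjecture.HodgeConjecture.Cruxes.HLiu418.K2LiuQRationalLFactor
open Summit.HodgeConjecture.HodgeConjecture.Cruxes.HLiu418.K2LiuLocalLFactorDefs
open Summit.HodgeConjecture.HodgeConjecture.Cruxes.HLiu418.K2LiuRankOneOperators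
open Summit.HodgeConjecture.HodgeConjecture.Cruxes.HLiu418.K2LiuRankOneFamiliesBase
open Summit.HodgeConjecture.HodgeConjecture.Cruxes.HLiu418.K2LiuRankOneStage
open Summit.HodgeConjecture.HodgeConjecture.Cruxes.HLiu418.K2LiuA7NormalisedRegularityAllS0
open Summit.HodgeConjecture.HodgeConjecture.Cruxes.HLiu418.K2LiuRankOneStageTwistedBall

namespace Summit.HodgeConjecture.HodgeConjecture.Cruxes.HLiu418.K2LiuRankOneStageValue

variable {K : Type} [Field K] [NumberField K] {w : HeightOneSpectrum (𝓞 K)} {G : Type*} [Group G] [TopologicalSpace G] [IsTopologicalGroup G]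
  [MeasurableSpace (w.adicCompletion K)] [BorelSpace (w.adicCompletion K)] (μ : Measure (w.adicCompletion K)) [μ.IsAddHaarMeasure]

/-! ## §1 The value clause at every convergent point, letters asked at the point -/

/-- **ONE STAGE OF THE COCYCLE, ALL `s₀`, WITH THE VALUE CLAUSE AT EVERY CONVERGENT POINT** (value edition of ★ `exists_normalised_family_allS0`: SAME binders, SAME
explicit `N` = ★ B3's normalised value at the per-point data, clauses (i)(ii) VERBATIM).  (i) for every `s₀`: `C₀` and all point values `q₀^{-s}`-regular at `s₀` ⟹ every
`s ↦ N s g` is; (ii) on `1 < re s`: `∫ Φ_s(w₀ u(x) g) dμ = L(a s + c − 1, ν) · N s g` with integrability; **(iii) at EVERY `s` with `1 < re (a s + c)` at which `Φ_s` is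
right-`K′`-invariant and satisfies the `SL₂` relation: `x ↦ Φ_s(w₀ u(x) g)` is integrable and `∫ Φ_s(w₀ u(x) g) dμ(x) = L(a s + c − 1, ν) · N s g`** — ★ B3
`integrable_and_integral_eq` ∕ `integral_eq_lFactor_mul_normalised` need `1 < re e` only, not `1 < re s`. [cite: Casselman1980, §3 Thm. 3.1] [cite: KudlaSweet1997, §1]
[cite: Tate1950, §2.5] -/
theorem exists_normalised_family_value (Φ : ℂ → G → ℂ) {K' : Subgroup G} (hK' : IsOpen (K' : Set G))
    (hΦK : ∀ s : ℂ, 1 < s.re → ∀ g, ∀ k ∈ K', Φ s (g * k) = Φ s g)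
    {u ū : w.adicCompletion K → G} (hu : Continuous u) (hu0 : u 0 = 1) (hū : Continuous ū) (hū0 : ū 0 = 1) (hu_add : ∀ x t, u (x + t) = u x * u t) (w₀ : G)
    (ν : (w.adicCompletion K)ˣ →* ℂˣ) (hν : ∀ x, ‖((ν x : ℂˣ) : ℂ)‖ = 1) (a : ℕ) (c : ℂ) (he : ∀ s : ℂ, 1 < s.re → 1 < ((a : ℂ) * s + c).re)
    (C₀ : ℂ → ℂ) (q₀ d : ℕ) (hq₀ : q₀ ≠ 0) (hq : residueFieldCard (w.adicCompletion K) = q₀ ^ d)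
    (hrel : ∀ s : ℂ, 1 < s.re → ∀ (x : (w.adicCompletion K)ˣ) (g : G),
      Φ s (w₀ * u x * g) = C₀ s * (((ν x)⁻¹ : ℂˣ) : ℂ) * ((normAbs (w.adicCompletion K) (x : w.adicCompletion K) : ℝ) : ℂ) ^ (-((a : ℂ) * s + c)) *
        Φ s (ū ((x⁻¹ : (w.adicCompletion K)ˣ) : w.adicCompletion K) * g)) :
    ∃ N : ℂ → G → ℂ,
      (∀ s₀ : ℂ, IsQRationalRegularAt q₀ s₀ C₀ → (∀ g, IsQRationalRegularAt q₀ s₀ fun s => Φ s g) →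
        ∀ g, IsQRationalRegularAt q₀ s₀ fun s => N s g) ∧
      (∀ s : ℂ, 1 < s.re → ∀ g,
        Integrable (fun x => Φ s (w₀ * u x * g)) μ ∧
          ∫ x, Φ s (w₀ * u x * g) ∂μ = lFactor K w ν ((a : ℂ) * s + c - 1) * N s g) ∧
      ∀ (s : ℂ) (g : G), 1 < ((a : ℂ) * s + c).re → (∀ g', ∀ k ∈ K', Φ s (g' * k) = Φ s g') →
        (∀ (x : (w.adicCompletion K)ˣ) (g' : G),
          Φ s (w₀ * u x * g') = C₀ s * (((ν x)⁻¹ : ℂˣ) : ℂ) * ((normAbs (w.adicCompletion K) (x : w.adicCompletion K) : ℝ) : ℂ) ^ (-((a : ℂ) * s + c)) *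
            Φ s (ū ((x⁻¹ : (w.adicCompletion K)ˣ) : w.adicCompletion K) * g')) →
        Integrable (fun x => Φ s (w₀ * u x * g)) μ ∧
          ∫ x, Φ s (w₀ * u x * g) ∂μ = lFactor K w ν ((a : ℂ) * s + c - 1) * N s g := by
  -- the per-point data, chosen once (independently of `s` and of `s₀`)
  choose m R hmu hmū hRinc hRcov using fun g => exists_level_and_reps hu hu0 hū hū0 K' hK' g
  refine ⟨fun s g =>
      (1 - unramValue K w ν * (residueFieldCard (w.adicCompletion K) : ℂ) ^ (-(((a : ℂ) * s + c) - 1))) *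
          (∑ b ∈ R g, (μ.real (primePowBall (w.adicCompletion K) (m g : ℤ)) : ℂ) * Φ s (w₀ * u b * g)) +
        C₀ s * Φ s g * (1 - (residueFieldCard (w.adicCompletion K) : ℂ)⁻¹) * μ.real (primePowBall (w.adicCompletion K) 0) *
          (unramValue K w ν * (residueFieldCard (w.adicCompletion K) : ℂ) ^ (1 - ((a : ℂ) * s + c))) ^ (m g + 1),
    fun s₀ hC₀ hreg g => isQRationalRegularAt_normalised_base_at μ q₀ d hq₀ hq Φ w₀ g ν a c C₀ (m g) (R g) s₀ hC₀ (hreg g) fun b _ => hreg _,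
    fun s hs g => ?_, fun s g hes hK hrels => ?_⟩
  · exact ⟨(integrable_and_integral_eq μ (hΦK s hs) hu_add w₀ ν hν _ (C₀ s) (he s hs) (hrel s hs) g (m g) (hmu g) (hmū g) (R g) (hRinc g) (hRcov g)).1,
      integral_eq_lFactor_mul_normalised μ (hΦK s hs) hu_add w₀ ν hν _ (C₀ s) (he s hs) (hrel s hs) g (m g) (hmu g) (hmū g) (R g) (hRinc g) (hRcov g)⟩
  · exact ⟨(integrable_and_integral_eq μ hK hu_add w₀ ν hν _ (C₀ s) hes hrels g (m g) (hmu g) (hmū g) (R g) (hRinc g) (hRcov g)).1,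
      integral_eq_lFactor_mul_normalised μ hK hu_add w₀ ν hν _ (C₀ s) hes hrels g (m g) (hmu g) (hmū g) (R g) (hRinc g) (hRcov g)⟩

/-! ## §2 The value clause at every convergent REGULAR point — continued families -/

/-- **THE VALUE CLAUSE AT EVERY CONVERGENT REGULAR POINT** (the form the chain consumes for a CONTINUED input family).  Same binders as `exists_normalised_family_value`
plus `2 ≤ q₀`; same `N`, clauses (i)(ii) VERBATIM, and **(iii′) at every `s₀` with `1 < re (a s₀ + c)` where `C₀` and all point values `s ↦ Φ_s(g′)` are `q₀^{-s}`-rational and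
regular: `x ↦ Φ_{s₀}(w₀ u(x) g)` is integrable and `∫ Φ_{s₀}(w₀ u(x) g) dμ = L(a s₀ + c − 1, ν) · N s₀ g`.**  The right-`K′`-invariance of `Φ_{s₀}` and its `SL₂` relation
are transferred from `1 < re s` by ★ `IsQRationalRegularAt.eq_of_eqOn_halfPlane` (both sides `q₀^{-s}`-rational and regular at `s₀`: point values, `C₀`, and the monomial
`‖x‖^{−(as+c)}` ★ p863296), then §1 (iii).  So the stage families of ★ p29's chain are LITERAL convergent integrals wherever `1 < re e(s₀)` — at `s₀ = ½` for stages A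
(`e = 2s+2`) and B (`e = 2s+1`). [cite: Casselman1980, §3 Thm. 3.1] [cite: KudlaSweet1997, §1] [cite: Tate1950, §2.5] -/
theorem exists_normalised_family_value_regular (Φ : ℂ → G → ℂ) {K' : Subgroup G} (hK' : IsOpen (K' : Set G))
    (hΦK : ∀ s : ℂ, 1 < s.re → ∀ g, ∀ k ∈ K', Φ s (g * k) = Φ s g)
    {u ū : w.adicCompletion K → G} (hu : Continuous u) (hu0 : u 0 = 1) (hū : Continuous ū) (hū0 : ū 0 = 1) (hu_add : ∀ x t, u (x + t) = u x * u t) (w₀ : G)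
    (ν : (w.adicCompletion K)ˣ →* ℂˣ) (hν : ∀ x, ‖((ν x : ℂˣ) : ℂ)‖ = 1) (a : ℕ) (c : ℂ) (he : ∀ s : ℂ, 1 < s.re → 1 < ((a : ℂ) * s + c).re)
    (C₀ : ℂ → ℂ) (q₀ d : ℕ) (hq₀ : 2 ≤ q₀) (hq : residueFieldCard (w.adicCompletion K) = q₀ ^ d)
    (hrel : ∀ s : ℂ, 1 < s.re → ∀ (x : (w.adicCompletion K)ˣ) (g : G),
      Φ s (w₀ * u x * g) = C₀ s * (((ν x)⁻¹ : ℂˣ) : ℂ) * ((normAbs (w.adicCompletion K) (x : w.adicCompletion K) : ℝ) : ℂ) ^ (-((a : ℂ) * s + c)) *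
        Φ s (ū ((x⁻¹ : (w.adicCompletion K)ˣ) : w.adicCompletion K) * g)) :
    ∃ N : ℂ → G → ℂ,
      (∀ s₀ : ℂ, IsQRationalRegularAt q₀ s₀ C₀ → (∀ g, IsQRationalRegularAt q₀ s₀ fun s => Φ s g) →
        ∀ g, IsQRationalRegularAt q₀ s₀ fun s => N s g) ∧
      (∀ s : ℂ, 1 < s.re → ∀ g,
        Integrable (fun x => Φ s (w₀ * u x * g)) μ ∧
          ∫ x, Φ s (w₀ * u x * g) ∂μ = lFactor K w ν ((a : ℂ) * s + c - 1) * N s g) ∧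
      ∀ (s₀ : ℂ) (g : G), 1 < ((a : ℂ) * s₀ + c).re → IsQRationalRegularAt q₀ s₀ C₀ → (∀ g' : G, IsQRationalRegularAt q₀ s₀ fun s => Φ s g') →
        Integrable (fun x => Φ s₀ (w₀ * u x * g)) μ ∧
          ∫ x, Φ s₀ (w₀ * u x * g) ∂μ = lFactor K w ν ((a : ℂ) * s₀ + c - 1) * N s₀ g := by
  have hq₀0 : q₀ ≠ 0 := by omega
  obtain ⟨N, hreg, hval, hpt⟩ := exists_normalised_family_value μ Φ hK' hΦK hu hu0 hū hū0 hu_add w₀ ν hν a c he C₀ q₀ d hq₀0 hq hrel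
  refine ⟨N, hreg, hval, fun s₀ g hes hC₀ hΦreg => hpt s₀ g hes (fun g' k' hk' => ?_) (fun x g' => ?_)⟩
  · -- right-`K′`-invariance at `s₀`, transferred from the half-plane
    exact IsQRationalRegularAt.eq_of_eqOn_halfPlane hq₀ (hΦreg (g' * k')) (hΦreg g') 1 fun s hs => hΦK s hs g' k' hk'
  · -- the `SL₂` relation at `s₀`, transferred from the half-plane
    have hmono := isQRationalRegularAt_normAbs_cpow_neg_affine (K := K) (w := w) q₀ d hq (x := (x : w.adicCompletion K)) x.ne_zero a c s₀
    have hR : IsQRationalRegularAt q₀ s₀ fun s => C₀ s * (((ν x)⁻¹ : ℂˣ) : ℂ) *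
        ((normAbs (w.adicCompletion K) (x : w.adicCompletion K) : ℝ) : ℂ) ^ (-((a : ℂ) * s + c)) *
          Φ s (ū ((x⁻¹ : (w.adicCompletion K)ˣ) : w.adicCompletion K) * g') :=
      ((hC₀.mul (isQRationalRegularAt_const q₀ s₀ _)).mul hmono).mul (hΦreg _)
    exact IsQRationalRegularAt.eq_of_eqOn_halfPlane hq₀ (hΦreg _) hR 1 fun s hs => hrel s hs x g'

end Summit.HodgeConjecture.HodgeConjecture.Cruxes.HLiu418.K2LiuRankOneStageValue

end
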